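import Summits.QuantumFields.YangMills.Theorems.BalabanUVNodesN15KingModelHeatKernelGradientSymbolBounds
import Summits.QuantumFields.YangMills.Theorems.BalabanUVNodesN15KingModelHeatKernelGradientCycle
import Summits.QuantumFields.YangMills.Theorems.BalabanUVNodesN15KingModelHeatKernelCycleDecay
import Literature.Analysis.Calculus.ForwardDifferenceLeibniz
import HarnessLib

/-!
# BalabanUVNodes ∕ N15 — THE KING-MODEL RUNG (PART ∇-c): THE DECAY OF THE DIFFERENCED CYCLE HEAT KERNEL —
# `‖∇Q^{(K)}_s(n)‖ ≤ (π∕2)⁴·P_∇(s,K)∕|v(n)|⁴` with `P_∇(s,K) = A(s)(9∕K + √(π∕(4s))) + (14s+84s²)·2π·(56∕K² + 1∕(4s) + (8∕K)√(π∕(8s)))`, `A(s) = 1 + 24s + (8+40s)√(2s)` —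
# `P_∇ = O(s)` for `s ≥ 1`, ONE HALF-POWER below PART Ϣ-e's `(14s+84s²)(9∕K+√(π∕(8s))) = O(s^{3∕2})` for `Q_s` itself (four summations by parts, Boole's Leibniz rule, half-power windows)
# (Track A, DAG node N15 = NE2; FAN-OUT v1.1 §N15 s3 «KING-MODEL RUNG … + what the curved case adds»; count-neutral)

HONEST FRAMING.  Count-neutral (cell `pub-ymgap`, seat `pub-ymgap-dag-n15-e` g57; `--supports stmt-QuantumFields-27247 --as helper` = K3ᴬ).  Finite sums on the cycle `ℤ∕K` about PART ∇-b's
`∇Q_s(n) = Q_s(n+1) − Q_s(n) = K⁻¹Σ_k g(k)ψ(kn)`, `g(k) = heat(2s)(θ_k)·(ψ(k)−1)`; no integrals, no field theory.  THE MECHANISM: (i) four summations by parts (PART Ϣ-d `charSum_iterate_fwdDiff`)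
`‖∇Q_s(n)‖ ≤ ‖ψ(−n)−1‖⁻⁴·K⁻¹Σ_k‖Δ_[1]^[4]g(k)‖`, `‖ψ(−n)−1‖⁻⁴ ≤ (K∕(4|v(n)|))⁴`; (ii) BOOLE's LEIBNIZ RULE (the tree's `Literature.Analysis.fwdDiff_iter_mul_eq_sum`, by name)
`Δ⁴(f·e)(k) = Σ_j C(4,j)·Δ^jf(k)·Δ^{4−j}e(k+j)` with `f = heat(2s)∘θ`, `e = ψ − 1`; (iii) the character side: `Δ^m(ψ−1) = Δ^mψ = (ψ(1)−1)^m·ψ` (Mathlib `fwdDiff_addChar_eq`) has norm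
`(2sin(π∕K))^m ≤ (2π∕K)^m` for `m ≥ 1`, and `Δ⁰(ψ−1)(k+4) = ψ(k+4)−1` has norm `≤ 2π(|v(k)|+4)∕K` (PART ∇-b); (iv) the symbol side: `|Δ^j_{2π∕K}heat(2s)(θ_k)| ≤ (2π∕K)^j·c_j·W_k` with the
HALF-POWER weights `c₀ = 1`, `c₁ = √σ`, `c₂ = 2σ`, `c₃ = (1+5σ)√σ` (`σ = 2s`, PART ∇-a) and the quarter-Gaussian window `W_k = e^{−(4s∕K²)((|v(k)|−4)₊)²}` (PART Ϣ-e's window geometry at a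
quarter instead of a half), and for `j = 4` PART Ϣ-e's own `(2π∕K)⁴(14s+84s²)W_k²`; (v) so `‖Δ⁴g(k)‖ ≤ (2π∕K)⁴[A(s)·W_k + (14s+84s²)W_k²·2π(|v(k)|+4)∕K]` and the `k`-sums are PART Ϣ-c's window sum
AT HALF TIME (`9∕K + √(π∕(4s))`) and the WEIGHTED window sum `K⁻²Σ_k(|v(k)|+4)W_k² ≤ 56∕K² + 1∕(4s) + (8∕K)√(π∕(8s))` (PART ∇-b's weighted shell `Σwe^{−aw²} ≤ 1∕a`); (vi) `(K∕(4v))⁴(2π∕K)⁴ = (π∕2)⁴∕v⁴`.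
WHY THE HALF-POWER MATTERS: in PART ∇-d's Region I (`s ≤ |v|²`) the product `‖∇Q_s(z_ν)‖·Π_{μ≠ν}‖Q_s(z_μ)‖` must be `O(|v|⁻⁴s^{−1∕2})` so that `∫₀^{|v|²}ds` gives `|v|⁻³`; with PART Ϣ-e's `O(s^{3∕2})`
decay for the differenced factor one would only recover the inverse SQUARE.
CONTENTS.  §1 the character side: `fwdDiff_stdAddChar_sub_one`, ★ `iterate_fwdDiff_stdAddChar_sub_one` (`m ≥ 1`), ★ `norm_iterate_fwdDiff_stdAddChar_sub_one_le` (`≤ (2π∕K)^m`),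
★ `norm_stdAddChar_add_nat_sub_one_le` (`‖ψ(k+m)−1‖ ≤ ‖ψ(k)−1‖ + m‖ψ(1)−1‖`), ★ `norm_stdAddChar_add_four_sub_one_le` (`≤ 2π(|v(k)|+4)∕K`); §2 the symbol side: def-free window weight,
★ `exp_quarter_le_window` (quarter-Gaussian window domination), ★★ `abs_iterate_fwdDiff_heat_le_window` (generic `j ≤ 4`, weight `c`), the four instances; §3 ★★ `cycle_weighted_window_sum_le`;
§4 ★★ **`norm_fourth_difference_grad_symbol_le`** (pointwise (v)), ★★ `cycle_fourth_difference_grad_sum_le` (summed), ★ `norm_cycleHeatGrad_le_of_fourth_difference` (step (i)), and ★★★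
**`norm_cycleHeatGrad_le_decay`** (the display in the title; `s > 0`, `n ≠ 0`, every `K ≥ 1`; absolute constants, no mass, no volume).
PRIOR TREE ART (by name): `Literature.Analysis.fwdDiff_iter_mul_eq_sum` (Boole 1860 ∕ Mariconda–Tonolo Prop. 6.13 — the Leibniz rule, NOT restated), Mathlib `fwdDiff_addChar_eq`; PART Ϣ-b
`abs_iterate_fwdDiff_le_of_chain`, Ϣ-c `cycle_window_sum_le` ∕ `sum_univ_absV_le` ∕ `sum_range_exp_neg_mul_sq_succ_le`, Ϣ-d `charSum_iterate_fwdDiff` ∕ `iterate_fwdDiff_pull` ∕ `ofReal_iterate_fwdDiff` ∕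
`exp_symbol_eq_heat`, Ϣ-e `one_sub_cos_ge_window` ∕ `abs_fourth_difference_heat_le` ∕ `inv_norm_char_pow_four_le`, ∇-a `abs_kingHeatD1∕D2∕D3_le`, ∇-b `cycleHeatGrad_eq_sum` ∕ `norm_stdAddChar_sub_one_le` ∕
`norm_stdAddChar_one_sub_one_le` ∕ `sum_range_succ_mul_exp_neg_mul_sq_le`.
Dedup (rg at filing): basename 0 files; needles `norm_cycleHeatGrad_le_decay|cycle_weighted_window_sum_le|abs_iterate_fwdDiff_heat_le_window|norm_fourth_difference_grad_symbol_le|iterate_fwdDiff_stdAddChar_sub_one` 0 tree files.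
Locators: [King1986] (4.4) p.670, (4.35) p.674, (3.63) p.663, proof of Lemma 4.1 p.671; [Boole2009] Ch. II Art. 10 Ex. 3 eq. (8); [LawlerLimic2010] §2.3.  0 `sorry`; 0 `def`.
-/

noncomputable section

open Real Set Finset Complex fwdDiff
open scoped BigOperators

namespace Summit.QuantumFields.YangMills.BalabanUVNodes.N15KingModelRung.HeatKernel

open Literature.Barriers.CriticalPhenomena.SRWGreen (heat heat_le_one heat_pos heat_periodic)

variable {K : ℕ} [NeZero K]

/-! ## §1 The character side: differences of `ψ − 1` -/

/-- `Δ_[1](ψ − 1) = Δ_[1]ψ` (constants have zero difference). [folklore] -/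
theorem fwdDiff_stdAddChar_sub_one :
    Δ_[(1 : ZMod K)] (fun k : ZMod K => (ZMod.stdAddChar k : ℂ) - 1) = Δ_[(1 : ZMod K)] (fun k : ZMod K => (ZMod.stdAddChar k : ℂ)) := by
  funext x; simp [fwdDiff]

/-- ★ `Δ_[1]^[m](ψ − 1)(k) = (ψ(1) − 1)^m·ψ(k)` for `m ≥ 1` (Mathlib `fwdDiff_addChar_eq` after the constant drops). [folklore] -/
theorem iterate_fwdDiff_stdAddChar_sub_one {m : ℕ} (hm : 1 ≤ m) (k : ZMod K) :
    (Δ_[(1 : ZMod K)])^[m] (fun k : ZMod K => (ZMod.stdAddChar k : ℂ) - 1) k = ((ZMod.stdAddChar (1 : ZMod K) : ℂ) - 1) ^ m * ZMod.stdAddChar k := by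
  obtain ⟨m', rfl⟩ := Nat.exists_eq_add_of_le hm
  rw [show 1 + m' = m' + 1 by ring, Function.iterate_succ_apply, fwdDiff_stdAddChar_sub_one, ← Function.iterate_succ_apply]
  exact fwdDiff_addChar_eq (ZMod.stdAddChar (N := K)) k 1 (m' + 1)

/-- ★ `‖Δ_[1]^[m](ψ − 1)(k)‖ ≤ (2π∕K)^m` for `m ≥ 1` (`‖ψ(1)−1‖ ≤ 2π∕K`, `‖ψ(k)‖ = 1`). [folklore] -/
theorem norm_iterate_fwdDiff_stdAddChar_sub_one_le {m : ℕ} (hm : 1 ≤ m) (k : ZMod K) :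
    ‖(Δ_[(1 : ZMod K)])^[m] (fun k : ZMod K => (ZMod.stdAddChar k : ℂ) - 1) k‖ ≤ (2 * π / K) ^ m := by
  rw [iterate_fwdDiff_stdAddChar_sub_one hm, norm_mul, norm_pow, norm_stdAddChar_eq_one, mul_one]
  exact pow_le_pow_left₀ (norm_nonneg _) norm_stdAddChar_one_sub_one_le m

/-- ★ `‖ψ(k + m) − 1‖ ≤ ‖ψ(k) − 1‖ + m·‖ψ(1) − 1‖` (`ψ(a+1) − 1 = ψ(a)(ψ(1)−1) + (ψ(a)−1)`). [folklore] -/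
theorem norm_stdAddChar_add_nat_sub_one_le (k : ZMod K) (m : ℕ) :
    ‖(ZMod.stdAddChar (k + (m : ZMod K)) : ℂ) - 1‖ ≤ ‖(ZMod.stdAddChar k : ℂ) - 1‖ + m * ‖(ZMod.stdAddChar (1 : ZMod K) : ℂ) - 1‖ := by
  induction m with
  | zero => simp
  | succ m ih =>
    have e : (ZMod.stdAddChar (k + ((m + 1 : ℕ) : ZMod K)) : ℂ) - 1
        = ZMod.stdAddChar (k + (m : ZMod K)) * (ZMod.stdAddChar (1 : ZMod K) - 1) + (ZMod.stdAddChar (k + (m : ZMod K)) - 1) := by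
      push_cast
      rw [← add_assoc, AddChar.map_add_eq_mul]
      ring
    rw [e]
    calc ‖(ZMod.stdAddChar (k + (m : ZMod K)) : ℂ) * (ZMod.stdAddChar (1 : ZMod K) - 1) + (ZMod.stdAddChar (k + (m : ZMod K)) - 1)‖
        ≤ ‖(ZMod.stdAddChar (k + (m : ZMod K)) : ℂ) * (ZMod.stdAddChar (1 : ZMod K) - 1)‖ + ‖(ZMod.stdAddChar (k + (m : ZMod K)) : ℂ) - 1‖ := norm_add_le _ _
      _ = ‖(ZMod.stdAddChar (1 : ZMod K) : ℂ) - 1‖ + ‖(ZMod.stdAddChar (k + (m : ZMod K)) : ℂ) - 1‖ := by rw [norm_mul, norm_stdAddChar_eq_one, one_mul]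
      _ ≤ ‖(ZMod.stdAddChar (1 : ZMod K) : ℂ) - 1‖ + (‖(ZMod.stdAddChar k : ℂ) - 1‖ + m * ‖(ZMod.stdAddChar (1 : ZMod K) : ℂ) - 1‖) := add_le_add le_rfl ih
      _ = ‖(ZMod.stdAddChar k : ℂ) - 1‖ + ((m + 1 : ℕ) : ℝ) * ‖(ZMod.stdAddChar (1 : ZMod K) : ℂ) - 1‖ := by push_cast; ring

/-- ★ `‖ψ(k + 4) − 1‖ ≤ 2π(|v(k)| + 4)∕K` — the one extra factor the `j = 4` Leibniz term carries (PART ∇-b `norm_stdAddChar_sub_one_le`, `norm_stdAddChar_one_sub_one_le`). [cite: King1986, (4.4) p.670] -/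
theorem norm_stdAddChar_add_four_sub_one_le (k : ZMod K) :
    ‖(ZMod.stdAddChar (k + ((4 : ℕ) : ZMod K)) : ℂ) - 1‖ ≤ 2 * π * (((k.valMinAbs.natAbs : ℕ) : ℝ) + 4) / K := by
  have hK : (0 : ℝ) < K := by exact_mod_cast Nat.pos_of_ne_zero (NeZero.ne K)
  have h1 := norm_stdAddChar_add_nat_sub_one_le k 4
  have h2 := norm_stdAddChar_sub_one_le k
  have h3 := norm_stdAddChar_one_sub_one_le (K := K)
  have e : 2 * π * (((k.valMinAbs.natAbs : ℕ) : ℝ) + 4) / K = 2 * π * ((k.valMinAbs.natAbs : ℕ) : ℝ) / K + 4 * (2 * π / K) := by ring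
  rw [e]
  push_cast at h1 ⊢
  linarith [mul_le_mul_of_nonneg_left h3 (by norm_num : (0:ℝ) ≤ 4)]

/-! ## §2 The symbol side: iterated differences of `heat(2s)` on the quarter-Gaussian windows -/

/-- ★ QUARTER-GAUSSIAN WINDOW DOMINATION: on the window `[θ_k, θ_k + 4·(2π∕K)]`, `e^{−(2s∕4)(1−cos ξ)} ≤ e^{−(8(s∕2)∕K²)((|v(k)|−4)₊)²}` (`s ≥ 0`; PART Ϣ-e `one_sub_cos_ge_window`).
[cite: King1986, (4.4) p.670, proof of Lemma 4.1 p.671] -/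
theorem exp_quarter_le_window {s : ℝ} (hs : 0 ≤ s) (k : ZMod K) {ξ : ℝ} (hξ : ξ ∈ Icc (cycAngle K k) (cycAngle K k + 4 * (2 * π / K))) :
    Real.exp (-(2 * s / 4 * (1 - Real.cos ξ))) ≤ Real.exp (-(8 * (s / 2) / (K : ℝ) ^ 2) * (((k.valMinAbs.natAbs - 4 : ℕ) : ℝ)) ^ 2) := by
  apply Real.exp_le_exp.mpr
  have hwin := one_sub_cos_ge_window k hξ
  have h := mul_le_mul_of_nonneg_left hwin (by positivity : (0 : ℝ) ≤ s / 2)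
  have e1 : s / 2 * (8 * (((k.valMinAbs.natAbs - 4 : ℕ) : ℝ)) ^ 2 / (K : ℝ) ^ 2) = (8 * (s / 2) / (K : ℝ) ^ 2) * (((k.valMinAbs.natAbs - 4 : ℕ) : ℝ)) ^ 2 := by ring
  have e2 : s / 2 * (1 - Real.cos ξ) = 2 * s / 4 * (1 - Real.cos ξ) := by ring
  rw [e1, e2] at h
  linarith

/-- ★★ **ITERATED DIFFERENCES OF THE HEAT SYMBOL ON THE CYCLE, GENERIC ORDER `j ≤ 4`**: if `|kingHeatChain (2s) j ξ| ≤ c·e^{−(2s∕4)(1−cos ξ)}` for all `ξ` (`c ≥ 0`), then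
`|Δ_[2π∕K]^[j] heat(2s)(θ_k)| ≤ (2π∕K)^j·c·e^{−(8(s∕2)∕K²)((|v(k)|−4)₊)²}` (PART Ϣ-b on the chain, the window `[θ_k, θ_k+jh] ⊆ [θ_k, θ_k+4h]`, quarter-Gaussian domination). [cite: King1986, (4.4) p.670] -/
theorem abs_iterate_fwdDiff_heat_le_window {s : ℝ} (hs : 0 ≤ s) {j : ℕ} (hj : j ≤ 4) {c : ℝ} (hc : 0 ≤ c)
    (hcj : ∀ ξ : ℝ, |kingHeatChain (2 * s) j ξ| ≤ c * Real.exp (-(2 * s / 4 * (1 - Real.cos ξ)))) (k : ZMod K) :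
    |(Δ_[2 * π / K])^[j] (heat (2 * s)) (cycAngle K k)| ≤ (2 * π / K) ^ j * (c * Real.exp (-(8 * (s / 2) / (K : ℝ) ^ 2) * (((k.valMinAbs.natAbs - 4 : ℕ) : ℝ)) ^ 2)) := by
  have hK : (0 : ℝ) < K := by exact_mod_cast Nat.pos_of_ne_zero (NeZero.ne K)
  have hh : 0 ≤ 2 * π / (K : ℝ) := by positivity
  have hchain : ∀ i < 4, ∀ x, HasDerivAt (kingHeatChain (2 * s) i) (kingHeatChain (2 * s) (i + 1) x) x :=
    fun i hi x => hasDerivAt_kingHeatChain (2 * s) hi x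
  have hB : ∀ ξ ∈ Icc (cycAngle K k) (cycAngle K k + j * (2 * π / K)),
      |kingHeatChain (2 * s) j ξ| ≤ c * Real.exp (-(8 * (s / 2) / (K : ℝ) ^ 2) * (((k.valMinAbs.natAbs - 4 : ℕ) : ℝ)) ^ 2) := by
    intro ξ hξ
    have hj' : (j : ℝ) ≤ 4 := by exact_mod_cast hj
    have hξ' : ξ ∈ Icc (cycAngle K k) (cycAngle K k + 4 * (2 * π / K)) := ⟨hξ.1, hξ.2.trans (by nlinarith)⟩
    exact (hcj ξ).trans (mul_le_mul_of_nonneg_left (exp_quarter_le_window hs k hξ') hc)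
  have h := abs_iterate_fwdDiff_le_of_chain j (kingHeatChain (2 * s)) 4 hj hchain hh (cycAngle K k) _ hB
  rw [kingHeatChain_zero] at h
  exact h

/-- Instance `j = 0`: `|heat(2s)(θ_k)| ≤ 1·W_k`. [folklore] -/
theorem abs_heat_le_window {s : ℝ} (hs : 0 ≤ s) (k : ZMod K) :
    |(Δ_[2 * π / K])^[0] (heat (2 * s)) (cycAngle K k)| ≤ (2 * π / K) ^ 0 * (1 * Real.exp (-(8 * (s / 2) / (K : ℝ) ^ 2) * (((k.valMinAbs.natAbs - 4 : ℕ) : ℝ)) ^ 2)) :=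
  abs_iterate_fwdDiff_heat_le_window hs (Nat.zero_le 4) zero_le_one (fun ξ => by rw [one_mul]; exact abs_kingHeatChain_zero_le (by positivity) ξ) k

/-- Instance `j = 1`: weight `√(2s)` (PART ∇-a `abs_kingHeatD1_le`). [folklore] -/
theorem abs_fwdDiff_heat_le_window {s : ℝ} (hs : 0 ≤ s) (k : ZMod K) :
    |(Δ_[2 * π / K])^[1] (heat (2 * s)) (cycAngle K k)| ≤ (2 * π / K) ^ 1 * (Real.sqrt (2 * s) * Real.exp (-(8 * (s / 2) / (K : ℝ) ^ 2) * (((k.valMinAbs.natAbs - 4 : ℕ) : ℝ)) ^ 2)) :=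
  abs_iterate_fwdDiff_heat_le_window hs (by norm_num) (Real.sqrt_nonneg _)
    (fun ξ => by have h := abs_kingHeatD1_le (σ := 2 * s) (by positivity) ξ; exact h) k

/-- Instance `j = 2`: weight `2·(2s)` (PART ∇-a `abs_kingHeatD2_le`). [folklore] -/
theorem abs_second_difference_heat_le_window {s : ℝ} (hs : 0 ≤ s) (k : ZMod K) :
    |(Δ_[2 * π / K])^[2] (heat (2 * s)) (cycAngle K k)| ≤ (2 * π / K) ^ 2 * (2 * (2 * s) * Real.exp (-(8 * (s / 2) / (K : ℝ) ^ 2) * (((k.valMinAbs.natAbs - 4 : ℕ) : ℝ)) ^ 2)) :=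
  abs_iterate_fwdDiff_heat_le_window hs (by norm_num) (by positivity)
    (fun ξ => by have h := abs_kingHeatD2_le (σ := 2 * s) (by positivity) ξ; exact h) k

/-- Instance `j = 3`: weight `(1+5·(2s))√(2s)` (PART ∇-a `abs_kingHeatD3_le`). [folklore] -/
theorem abs_third_difference_heat_le_window {s : ℝ} (hs : 0 ≤ s) (k : ZMod K) :
    |(Δ_[2 * π / K])^[3] (heat (2 * s)) (cycAngle K k)|
      ≤ (2 * π / K) ^ 3 * ((1 + 5 * (2 * s)) * Real.sqrt (2 * s) * Real.exp (-(8 * (s / 2) / (K : ℝ) ^ 2) * (((k.valMinAbs.natAbs - 4 : ℕ) : ℝ)) ^ 2)) :=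
  abs_iterate_fwdDiff_heat_le_window hs (by norm_num) (by positivity)
    (fun ξ => by have h := abs_kingHeatD3_le (σ := 2 * s) (by positivity) ξ; exact h) k

/-! ## §3 The weighted window sum -/

/-- ★★ **THE WEIGHTED WINDOW SUM**: `K⁻¹Σ_{k∈ℤ∕K} ((|v(k)|+4)∕K)·e^{−(8s∕K²)((|v(k)|−4)₊)²} ≤ 56∕K² + 1∕(4s) + (8∕K)√(π∕(8s))` for `s > 0` — the nine classes `|v| ≤ 4` cost `≤ 56`, the rest is
`Σ_{w≥1}(w+8)e^{−aw²} ≤ 1∕a + 4√(π∕a)` per sign (`a = 8s∕K²`; PART ∇-b's weighted shell and PART Ϣ-c's shell). [cite: King1986, (4.4) p.670, (4.35) p.674] -/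
theorem cycle_weighted_window_sum_le {s : ℝ} (hs : 0 < s) :
    (K : ℝ)⁻¹ * ∑ k : ZMod K, (((k.valMinAbs.natAbs : ℕ) : ℝ) + 4) / K * Real.exp (-(8 * s / (K : ℝ) ^ 2) * (((k.valMinAbs.natAbs - 4 : ℕ) : ℝ)) ^ 2)
      ≤ 56 / (K : ℝ) ^ 2 + 1 / (4 * s) + 8 / K * Real.sqrt (π / (8 * s)) := by
  have hK : (0 : ℝ) < K := by exact_mod_cast Nat.pos_of_ne_zero (NeZero.ne K)
  have ha : 0 < 8 * s / (K : ℝ) ^ 2 := by positivity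
  set a : ℝ := 8 * s / (K : ℝ) ^ 2 with hadef
  set φ : ℕ → ℝ := fun w => ((w : ℝ) + 4) * Real.exp (-a * (((w - 4 : ℕ) : ℝ)) ^ 2) with hφ
  have hφ0 : ∀ w, 0 ≤ φ w := fun w => by simp only [hφ]; positivity
  have hexp1 : ∀ w : ℕ, Real.exp (-a * (((w - 4 : ℕ) : ℝ)) ^ 2) ≤ 1 := fun w => by
    rw [Real.exp_le_one_iff, neg_mul, neg_nonpos]; positivity
  -- rewrite the summand through `φ(|v(k)|)`
  have hre : ∑ k : ZMod K, (((k.valMinAbs.natAbs : ℕ) : ℝ) + 4) / K * Real.exp (-(8 * s / (K : ℝ) ^ 2) * (((k.valMinAbs.natAbs - 4 : ℕ) : ℝ)) ^ 2)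
      = (K : ℝ)⁻¹ * ∑ k : ZMod K, φ (k.valMinAbs.natAbs) := by
    rw [Finset.mul_sum]
    refine Finset.sum_congr rfl fun k _ => ?_
    simp only [hφ, hadef]
    ring
  have h2 := sum_univ_absV_le (K := K) φ hφ0
  have hφz : φ 0 = 4 := by simp [hφ]
  rw [hφz] at h2
  -- the range split at `4`
  have hsplit : ∑ i ∈ Finset.range (K / 2), φ (i + 1)
      ≤ 26 + (∑ j ∈ Finset.range (K / 2 - 4), ((j + 1 : ℕ) : ℝ) * Real.exp (-a * ((j + 1 : ℕ) : ℝ) ^ 2)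
        + 8 * ∑ j ∈ Finset.range (K / 2 - 4), Real.exp (-a * ((j + 1 : ℕ) : ℝ) ^ 2)) := by
    have hhead : ∀ i, i < 4 → φ (i + 1) ≤ (i : ℝ) + 5 := by
      intro i hi
      simp only [hφ]
      have : (i + 1 - 4 : ℕ) = 0 := by omega
      rw [this]
      push_cast
      simp
      linarith
    by_cases hM : 4 ≤ K / 2
    · have e : K / 2 = 4 + (K / 2 - 4) := by omega
      rw [e, Finset.sum_range_add, Nat.add_sub_cancel_left]
      have hA : ∑ i ∈ Finset.range 4, φ (i + 1) ≤ 26 := by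
        simp only [Finset.sum_range_succ, Finset.sum_range_zero, zero_add]
        have h0 := hhead 0 (by norm_num); have h1 := hhead 1 (by norm_num); have h2 := hhead 2 (by norm_num); have h3 := hhead 3 (by norm_num)
        push_cast at h0 h1 h2 h3
        linarith
      have hB : ∑ j ∈ Finset.range (K / 2 - 4), φ (4 + j + 1)
          = ∑ j ∈ Finset.range (K / 2 - 4), ((j + 1 : ℕ) : ℝ) * Real.exp (-a * ((j + 1 : ℕ) : ℝ) ^ 2) + 8 * ∑ j ∈ Finset.range (K / 2 - 4), Real.exp (-a * ((j + 1 : ℕ) : ℝ) ^ 2) := by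
        rw [Finset.mul_sum, ← Finset.sum_add_distrib]
        refine Finset.sum_congr rfl fun j _ => ?_
        simp only [hφ]
        have : (4 + j + 1 - 4 : ℕ) = j + 1 := by omega
        rw [this]
        push_cast
        ring
      linarith [hA, hB.le, hB.ge]
    · push Not at hM
      have hA : ∑ i ∈ Finset.range (K / 2), φ (i + 1) ≤ 26 := by
        have hle : ∑ i ∈ Finset.range (K / 2), φ (i + 1) ≤ ∑ i ∈ Finset.range 4, φ (i + 1) :=
          Finset.sum_le_sum_of_subset_of_nonneg (Finset.range_subset_range.2 hM.le) (fun i _ _ => hφ0 _)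
        refine hle.trans ?_
        simp only [Finset.sum_range_succ, Finset.sum_range_zero, zero_add]
        have h0 := hhead 0 (by norm_num); have h1 := hhead 1 (by norm_num); have h2 := hhead 2 (by norm_num); have h3 := hhead 3 (by norm_num)
        push_cast at h0 h1 h2 h3
        linarith
      have hB1 : 0 ≤ ∑ j ∈ Finset.range (K / 2 - 4), ((j + 1 : ℕ) : ℝ) * Real.exp (-a * ((j + 1 : ℕ) : ℝ) ^ 2) := Finset.sum_nonneg fun j _ => by positivity
      have hB2 : 0 ≤ ∑ j ∈ Finset.range (K / 2 - 4), Real.exp (-a * ((j + 1 : ℕ) : ℝ) ^ 2) := Finset.sum_nonneg fun j _ => (Real.exp_pos _).le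
      linarith
  have hw := sum_range_succ_mul_exp_neg_mul_sq_le ha (K / 2 - 4)
  have htail := sum_range_exp_neg_mul_sq_succ_le ha (K / 2 - 4)
  have hsq : Real.sqrt (π / a) = (K : ℝ) * Real.sqrt (π / (8 * s)) := by
    rw [hadef, show π / (8 * s / (K : ℝ) ^ 2) = (K : ℝ) ^ 2 * (π / (8 * s)) by field_simp]
    rw [Real.sqrt_mul (sq_nonneg _), Real.sqrt_sq hK.le]
  rw [hsq] at htail
  have h1a : 1 / a = (K : ℝ) ^ 2 / (8 * s) := by rw [hadef]; field_simp
  rw [h1a] at hw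
  have h4 : ∑ k : ZMod K, φ (k.valMinAbs.natAbs) ≤ 56 + 2 * ((K : ℝ) ^ 2 / (8 * s)) + 8 * ((K : ℝ) * Real.sqrt (π / (8 * s))) := by
    have := hsplit
    nlinarith [h2, hsplit, hw, htail]
  rw [hre]
  calc (K : ℝ)⁻¹ * ((K : ℝ)⁻¹ * ∑ k : ZMod K, φ (k.valMinAbs.natAbs))
      ≤ (K : ℝ)⁻¹ * ((K : ℝ)⁻¹ * (56 + 2 * ((K : ℝ) ^ 2 / (8 * s)) + 8 * ((K : ℝ) * Real.sqrt (π / (8 * s))))) := by gcongr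
    _ = 56 / (K : ℝ) ^ 2 + 1 / (4 * s) + 8 / K * Real.sqrt (π / (8 * s)) := by field_simp; ring

/-! ## §4 Boole's Leibniz rule, the pointwise bound, the sums, and the decay of `∇Q` -/

/-- Five-term norms: `‖a+b+c+d+e‖ ≤ ‖a‖+‖b‖+‖c‖+‖d‖+‖e‖`. [folklore] -/
theorem norm_add_five_le (a b c d e : ℂ) : ‖a + b + c + d + e‖ ≤ ‖a‖ + ‖b‖ + ‖c‖ + ‖d‖ + ‖e‖ := by
  linarith [norm_add_le (a + b + c + d) e, norm_add_le (a + b + c) d, norm_add_le (a + b) c, norm_add_le a b]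

/-- ★★ **THE POINTWISE BOUND ON THE FOURTH DIFFERENCES OF `g = heat(2s)∘θ · (ψ − 1)`** (`s ≥ 0`, every class `k`):
`‖Δ_[1]^[4] g(k)‖ ≤ (2π∕K)⁴·[(1 + 24s + (8+40s)√(2s))·W_k + (14s+84s²)·W_k²·2π(|v(k)|+4)∕K]`, `W_k = e^{−(8(s∕2)∕K²)((|v(k)|−4)₊)²}` (`W_k²` spelled `e^{−(8s∕K²)(…)²}`) — Boole's Leibniz
rule (`Literature.Analysis.fwdDiff_iter_mul_eq_sum`), §1 for the character factors, §2 and PART Ϣ-e for the symbol factors. [cite: King1986, (4.4) p.670, (4.35) p.674; Boole2009, Ch. II Art. 10 Ex. 3 eq. (8)] -/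
theorem norm_fourth_difference_grad_symbol_le {s : ℝ} (hs : 0 ≤ s) (k : ZMod K) :
    ‖(Δ_[(1 : ZMod K)])^[4] ((fun k' : ZMod K => ((heat (2 * s) (cycAngle K k') : ℝ) : ℂ)) * (fun k' : ZMod K => (ZMod.stdAddChar k' : ℂ) - 1)) k‖
      ≤ (2 * π / K) ^ 4 * ((1 + 24 * s + (8 + 40 * s) * Real.sqrt (2 * s)) * Real.exp (-(8 * (s / 2) / (K : ℝ) ^ 2) * (((k.valMinAbs.natAbs - 4 : ℕ) : ℝ)) ^ 2)
        + (14 * s + 84 * s ^ 2) * Real.exp (-(8 * s / (K : ℝ) ^ 2) * (((k.valMinAbs.natAbs - 4 : ℕ) : ℝ)) ^ 2) * (2 * π * (((k.valMinAbs.natAbs : ℕ) : ℝ) + 4) / K)) := by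
  have hK : (0 : ℝ) < K := by exact_mod_cast Nat.pos_of_ne_zero (NeZero.ne K)
  set f : ZMod K → ℂ := fun k' => ((heat (2 * s) (cycAngle K k') : ℝ) : ℂ) with hfdef
  set e : ZMod K → ℂ := fun k' => (ZMod.stdAddChar k' : ℂ) - 1 with hedef
  set h : ℝ := 2 * π / K with hh
  set W : ℝ := Real.exp (-(8 * (s / 2) / (K : ℝ) ^ 2) * (((k.valMinAbs.natAbs - 4 : ℕ) : ℝ)) ^ 2) with hW
  set E : ℝ := Real.exp (-(8 * s / (K : ℝ) ^ 2) * (((k.valMinAbs.natAbs - 4 : ℕ) : ℝ)) ^ 2) with hE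
  set V : ℝ := 2 * π * (((k.valMinAbs.natAbs : ℕ) : ℝ) + 4) / K with hV
  have hh0 : 0 ≤ h := by positivity
  have hW0 : 0 ≤ W := (Real.exp_pos _).le
  have hE0 : 0 ≤ E := (Real.exp_pos _).le
  have hV0 : 0 ≤ V := by positivity
  -- the symbol side, in complex clothing
  have hf : ∀ j : ℕ, ‖(Δ_[(1 : ZMod K)])^[j] f k‖ = |(Δ_[2 * π / K])^[j] (heat (2 * s)) (cycAngle K k)| := by
    intro j
    rw [hfdef, ← ofReal_iterate_fwdDiff (1 : ZMod K) j (fun k' => heat (2 * s) (cycAngle K k')) k,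
      iterate_fwdDiff_pull (heat_periodic (2 * s)) j k, Complex.norm_real, Real.norm_eq_abs]
  have hF0 : ‖(Δ_[(1 : ZMod K)])^[0] f k‖ ≤ h ^ 0 * (1 * W) := by rw [hf]; exact abs_heat_le_window hs k
  have hF1 : ‖(Δ_[(1 : ZMod K)])^[1] f k‖ ≤ h ^ 1 * (Real.sqrt (2 * s) * W) := by rw [hf]; exact abs_fwdDiff_heat_le_window hs k
  have hF2 : ‖(Δ_[(1 : ZMod K)])^[2] f k‖ ≤ h ^ 2 * (2 * (2 * s) * W) := by rw [hf]; exact abs_second_difference_heat_le_window hs k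
  have hF3 : ‖(Δ_[(1 : ZMod K)])^[3] f k‖ ≤ h ^ 3 * ((1 + 5 * (2 * s)) * Real.sqrt (2 * s) * W) := by rw [hf]; exact abs_third_difference_heat_le_window hs k
  have hF4 : ‖(Δ_[(1 : ZMod K)])^[4] f k‖ ≤ h ^ 4 * ((14 * s + 84 * s ^ 2) * E) := by rw [hf]; exact abs_fourth_difference_heat_le hs k
  -- the character side
  have hEm : ∀ m : ℕ, 1 ≤ m → ∀ k' : ZMod K, ‖(Δ_[(1 : ZMod K)])^[m] e k'‖ ≤ h ^ m := fun m hm k' => norm_iterate_fwdDiff_stdAddChar_sub_one_le hm k'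
  have hEz : ‖(Δ_[(1 : ZMod K)])^[4 - 4] e (k + 4 • (1 : ZMod K))‖ ≤ V := by
    rw [Nat.sub_self, Function.iterate_zero, id_eq, nsmul_one, hedef]
    exact norm_stdAddChar_add_four_sub_one_le k
  -- Boole's Leibniz rule
  have hexp : (Δ_[(1 : ZMod K)])^[4] (f * e) k
      = ∑ j ∈ Finset.range (4 + 1), ((Nat.choose 4 j : ℕ) : ℂ) * ((Δ_[(1 : ZMod K)])^[j] f k * (Δ_[(1 : ZMod K)])^[4 - j] e (k + j • (1 : ZMod K))) :=
    Literature.Analysis.fwdDiff_iter_mul_eq_sum (1 : ZMod K) f e 4 k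
  rw [hexp, Finset.sum_range_succ, Finset.sum_range_succ, Finset.sum_range_succ, Finset.sum_range_succ, Finset.sum_range_succ, Finset.sum_range_zero, zero_add]
  -- the five terms
  have hT : ∀ j : ℕ, j ≤ 3 → ∀ (Bf : ℝ), ‖(Δ_[(1 : ZMod K)])^[j] f k‖ ≤ h ^ j * Bf → 0 ≤ Bf →
      ‖((Nat.choose 4 j : ℕ) : ℂ) * ((Δ_[(1 : ZMod K)])^[j] f k * (Δ_[(1 : ZMod K)])^[4 - j] e (k + j • (1 : ZMod K)))‖ ≤ (Nat.choose 4 j : ℝ) * (h ^ 4 * Bf) := by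
    intro j hj Bf hBf hBf0
    rw [norm_mul, norm_mul, Complex.norm_natCast]
    refine mul_le_mul_of_nonneg_left ?_ (by positivity)
    have h2 := hEm (4 - j) (by omega) (k + j • (1 : ZMod K))
    calc ‖(Δ_[(1 : ZMod K)])^[j] f k‖ * ‖(Δ_[(1 : ZMod K)])^[4 - j] e (k + j • (1 : ZMod K))‖ ≤ (h ^ j * Bf) * h ^ (4 - j) :=
          mul_le_mul hBf h2 (norm_nonneg _) (by positivity)
      _ = h ^ (j + (4 - j)) * Bf := by rw [pow_add]; ring
      _ = h ^ 4 * Bf := by rw [show j + (4 - j) = 4 by omega]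
  have b0 := hT 0 (by norm_num) (1 * W) hF0 (by positivity)
  have b1 := hT 1 (by norm_num) (Real.sqrt (2 * s) * W) hF1 (by positivity)
  have b2 := hT 2 (by norm_num) (2 * (2 * s) * W) hF2 (by positivity)
  have b3 := hT 3 (by norm_num) ((1 + 5 * (2 * s)) * Real.sqrt (2 * s) * W) hF3 (by positivity)
  have b4 : ‖((Nat.choose 4 4 : ℕ) : ℂ) * ((Δ_[(1 : ZMod K)])^[4] f k * (Δ_[(1 : ZMod K)])^[4 - 4] e (k + 4 • (1 : ZMod K)))‖ ≤ (Nat.choose 4 4 : ℝ) * (h ^ 4 * ((14 * s + 84 * s ^ 2) * E) * V) := by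
    rw [norm_mul, norm_mul, Complex.norm_natCast]
    refine mul_le_mul_of_nonneg_left ?_ (by positivity)
    exact mul_le_mul hF4 hEz (norm_nonneg _) (by positivity)
  have hc0 : (Nat.choose 4 0 : ℝ) = 1 := by norm_num [Nat.choose]
  have hc1 : (Nat.choose 4 1 : ℝ) = 4 := by norm_num [Nat.choose]
  have hc2 : (Nat.choose 4 2 : ℝ) = 6 := by norm_num [Nat.choose]
  have hc3 : (Nat.choose 4 3 : ℝ) = 4 := by norm_num [Nat.choose]
  have hc4 : (Nat.choose 4 4 : ℝ) = 1 := by norm_num [Nat.choose]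
  rw [hc0] at b0; rw [hc1] at b1; rw [hc2] at b2; rw [hc3] at b3; rw [hc4] at b4
  have halg : 1 * (h ^ 4 * (1 * W)) + 4 * (h ^ 4 * (Real.sqrt (2 * s) * W)) + 6 * (h ^ 4 * (2 * (2 * s) * W))
      + 4 * (h ^ 4 * ((1 + 5 * (2 * s)) * Real.sqrt (2 * s) * W)) + 1 * (h ^ 4 * ((14 * s + 84 * s ^ 2) * E) * V)
      = h ^ 4 * ((1 + 24 * s + (8 + 40 * s) * Real.sqrt (2 * s)) * W + (14 * s + 84 * s ^ 2) * E * V) := by ring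
  refine (norm_add_five_le _ _ _ _ _).trans ?_
  rw [← halg]
  linarith [b0, b1, b2, b3, b4]

/-- ★★ … SUMMED OVER THE CYCLE (`s > 0`): `K⁻¹Σ_k‖Δ_[1]^[4]g(k)‖ ≤ (2π∕K)⁴·[(1+24s+(8+40s)√(2s))·(9∕K + √(π∕(8(s∕2)))) + (14s+84s²)·2π·(56∕K² + 1∕(4s) + (8∕K)√(π∕(8s)))]`
(PART Ϣ-c's window sum at half time; §3's weighted window sum). [cite: King1986, (4.4) p.670, (4.35) p.674] -/
theorem cycle_fourth_difference_grad_sum_le {s : ℝ} (hs : 0 < s) :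
    (K : ℝ)⁻¹ * ∑ k : ZMod K, ‖(Δ_[(1 : ZMod K)])^[4] ((fun k' : ZMod K => ((heat (2 * s) (cycAngle K k') : ℝ) : ℂ)) * (fun k' : ZMod K => (ZMod.stdAddChar k' : ℂ) - 1)) k‖
      ≤ (2 * π / K) ^ 4 * ((1 + 24 * s + (8 + 40 * s) * Real.sqrt (2 * s)) * (9 * (K : ℝ)⁻¹ + Real.sqrt (π / (8 * (s / 2))))
        + (14 * s + 84 * s ^ 2) * (2 * π) * (56 / (K : ℝ) ^ 2 + 1 / (4 * s) + 8 / K * Real.sqrt (π / (8 * s)))) := by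
  have hK : (0 : ℝ) < K := by exact_mod_cast Nat.pos_of_ne_zero (NeZero.ne K)
  have hpt := fun k : ZMod K => norm_fourth_difference_grad_symbol_le (K := K) hs.le k
  have h1 := Finset.sum_le_sum fun k (_ : k ∈ (Finset.univ : Finset (ZMod K))) => hpt k
  have hw := cycle_window_sum_le (K := K) (s := s / 2) (by positivity)
  have hww := cycle_weighted_window_sum_le (K := K) hs
  have hA0 : 0 ≤ 1 + 24 * s + (8 + 40 * s) * Real.sqrt (2 * s) := by positivity
  have hP0 : 0 ≤ 14 * s + 84 * s ^ 2 := by positivity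
  -- reorganise the right-hand sum
  have hre : ∑ k : ZMod K, (2 * π / K) ^ 4 * ((1 + 24 * s + (8 + 40 * s) * Real.sqrt (2 * s)) * Real.exp (-(8 * (s / 2) / (K : ℝ) ^ 2) * (((k.valMinAbs.natAbs - 4 : ℕ) : ℝ)) ^ 2)
        + (14 * s + 84 * s ^ 2) * Real.exp (-(8 * s / (K : ℝ) ^ 2) * (((k.valMinAbs.natAbs - 4 : ℕ) : ℝ)) ^ 2) * (2 * π * (((k.valMinAbs.natAbs : ℕ) : ℝ) + 4) / K))
      = (2 * π / K) ^ 4 * ((1 + 24 * s + (8 + 40 * s) * Real.sqrt (2 * s)) * ∑ k : ZMod K, Real.exp (-(8 * (s / 2) / (K : ℝ) ^ 2) * (((k.valMinAbs.natAbs - 4 : ℕ) : ℝ)) ^ 2)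
        + (14 * s + 84 * s ^ 2) * (2 * π) * ∑ k : ZMod K, (((k.valMinAbs.natAbs : ℕ) : ℝ) + 4) / K * Real.exp (-(8 * s / (K : ℝ) ^ 2) * (((k.valMinAbs.natAbs - 4 : ℕ) : ℝ)) ^ 2)) := by
    rw [Finset.mul_sum, Finset.mul_sum, ← Finset.sum_add_distrib, Finset.mul_sum]
    refine Finset.sum_congr rfl fun k _ => ?_
    ring
  rw [hre] at h1
  calc (K : ℝ)⁻¹ * ∑ k : ZMod K, ‖(Δ_[(1 : ZMod K)])^[4] ((fun k' : ZMod K => ((heat (2 * s) (cycAngle K k') : ℝ) : ℂ)) * (fun k' : ZMod K => (ZMod.stdAddChar k' : ℂ) - 1)) k‖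
      ≤ (K : ℝ)⁻¹ * ((2 * π / K) ^ 4 * ((1 + 24 * s + (8 + 40 * s) * Real.sqrt (2 * s)) * ∑ k : ZMod K, Real.exp (-(8 * (s / 2) / (K : ℝ) ^ 2) * (((k.valMinAbs.natAbs - 4 : ℕ) : ℝ)) ^ 2)
        + (14 * s + 84 * s ^ 2) * (2 * π) * ∑ k : ZMod K, (((k.valMinAbs.natAbs : ℕ) : ℝ) + 4) / K * Real.exp (-(8 * s / (K : ℝ) ^ 2) * (((k.valMinAbs.natAbs - 4 : ℕ) : ℝ)) ^ 2))) :=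
        mul_le_mul_of_nonneg_left h1 (by positivity)
    _ = (2 * π / K) ^ 4 * ((1 + 24 * s + (8 + 40 * s) * Real.sqrt (2 * s)) * ((K : ℝ)⁻¹ * ∑ k : ZMod K, Real.exp (-(8 * (s / 2) / (K : ℝ) ^ 2) * (((k.valMinAbs.natAbs - 4 : ℕ) : ℝ)) ^ 2))
        + (14 * s + 84 * s ^ 2) * (2 * π) * ((K : ℝ)⁻¹ * ∑ k : ZMod K, (((k.valMinAbs.natAbs : ℕ) : ℝ) + 4) / K * Real.exp (-(8 * s / (K : ℝ) ^ 2) * (((k.valMinAbs.natAbs - 4 : ℕ) : ℝ)) ^ 2))) := by ring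
    _ ≤ (2 * π / K) ^ 4 * ((1 + 24 * s + (8 + 40 * s) * Real.sqrt (2 * s)) * (9 * (K : ℝ)⁻¹ + Real.sqrt (π / (8 * (s / 2))))
        + (14 * s + 84 * s ^ 2) * (2 * π) * (56 / (K : ℝ) ^ 2 + 1 / (4 * s) + 8 / K * Real.sqrt (π / (8 * s)))) := by
        gcongr

/-- ★ STEP (i): `‖∇Q_s(n)‖ ≤ ‖ψ(−n)−1‖⁻⁴·K⁻¹Σ_k‖Δ_[1]^[4]g(k)‖` for `n ≠ 0`, `g = heat(2s)∘θ·(ψ−1)` (PART ∇-b's Fourier form + PART Ϣ-d's four summations by parts). [cite: King1986, (4.35) p.674] -/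
theorem norm_cycleHeatGrad_le_of_fourth_difference (s : ℝ) {n : ZMod K} (hn : n ≠ 0) :
    ‖cycleHeatGrad K s n‖ ≤ (‖(ZMod.stdAddChar (-n) : ℂ) - 1‖ ^ 4)⁻¹ *
      ((K : ℝ)⁻¹ * ∑ k : ZMod K, ‖(Δ_[(1 : ZMod K)])^[4] ((fun k' : ZMod K => ((heat (2 * s) (cycAngle K k') : ℝ) : ℂ)) * (fun k' : ZMod K => (ZMod.stdAddChar k' : ℂ) - 1)) k‖) := by
  have hK : (0 : ℝ) < K := by exact_mod_cast Nat.pos_of_ne_zero (NeZero.ne K)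
  have hψ := norm_stdAddChar_neg_sub_one_pos (K := K) hn
  set g : ZMod K → ℂ := (fun k' : ZMod K => ((heat (2 * s) (cycAngle K k') : ℝ) : ℂ)) * (fun k' : ZMod K => (ZMod.stdAddChar k' : ℂ) - 1) with hg
  have hsum : cycleHeatGrad K s n = (K : ℂ)⁻¹ * ∑ k : ZMod K, g k * ZMod.stdAddChar (k * n) := by
    rw [cycleHeatGrad_eq_sum]
    congr 1
    refine Finset.sum_congr rfl fun k _ => ?_
    rw [exp_symbol_eq_heat, hg, Pi.mul_apply]
    ring
  have hsbp := charSum_iterate_fwdDiff (K := K) 4 g n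
  have hS : ∑ k : ZMod K, g k * ZMod.stdAddChar (k * n)
      = ((ZMod.stdAddChar (-n) - 1) ^ 4)⁻¹ * ∑ k : ZMod K, ((Δ_[1])^[4] g) k * ZMod.stdAddChar (k * n) := by
    rw [hsbp, ← mul_assoc, inv_mul_cancel₀ (pow_ne_zero 4 (norm_pos_iff.mp hψ)), one_mul]
  rw [hsum, hS, norm_mul, norm_mul, norm_inv, norm_inv, norm_pow]
  have hKn : ‖(K : ℂ)‖ = (K : ℝ) := by simp
  rw [hKn]
  have hle : ‖∑ k : ZMod K, ((Δ_[1])^[4] g) k * ZMod.stdAddChar (k * n)‖ ≤ ∑ k : ZMod K, ‖((Δ_[1])^[4] g) k‖ := by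
    refine (norm_sum_le _ _).trans (le_of_eq (Finset.sum_congr rfl fun k _ => ?_))
    rw [norm_mul, norm_stdAddChar_eq_one, mul_one]
  calc (K : ℝ)⁻¹ * ((‖(ZMod.stdAddChar (-n) : ℂ) - 1‖ ^ 4)⁻¹ * ‖∑ k : ZMod K, ((Δ_[1])^[4] g) k * ZMod.stdAddChar (k * n)‖)
      ≤ (K : ℝ)⁻¹ * ((‖(ZMod.stdAddChar (-n) : ℂ) - 1‖ ^ 4)⁻¹ * ∑ k : ZMod K, ‖((Δ_[1])^[4] g) k‖) := by gcongr
    _ = _ := by ring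

/-- ★★★ **THE DECAY OF THE DIFFERENCED CYCLE HEAT KERNEL**: for every `K ≥ 1`, `s > 0`, `n ≠ 0` in `ℤ∕K`,
`‖∇Q^{(K)}_s(n)‖ ≤ (π∕2)⁴·[(1+24s+(8+40s)√(2s))·(9∕K + √(π∕(8(s∕2)))) + (14s+84s²)·2π·(56∕K² + 1∕(4s) + (8∕K)√(π∕(8s)))] ∕ |v(n)|⁴` — four summations by parts, Boole's Leibniz rule,
the half-power Gaussian localisations of `∂^jheat` (`j ≤ 3`), the window geometry at a quarter, PART Ϣ-c's window sum and the weighted window sum; for `1 ≤ s ≤ K²` the bracket is `O(s)`,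
ONE HALF-POWER below the `O(s^{3∕2})` of PART Ϣ-e's bound for `Q_s(n)` itself; absolute constants, no mass, no volume. [cite: King1986, (4.4) p.670, (4.35) p.674, (3.63) p.663] -/
theorem norm_cycleHeatGrad_le_decay {s : ℝ} (hs : 0 < s) {n : ZMod K} (hn : n ≠ 0) :
    ‖cycleHeatGrad K s n‖ ≤ (π / 2) ^ 4 * ((1 + 24 * s + (8 + 40 * s) * Real.sqrt (2 * s)) * (9 * (K : ℝ)⁻¹ + Real.sqrt (π / (8 * (s / 2))))
        + (14 * s + 84 * s ^ 2) * (2 * π) * (56 / (K : ℝ) ^ 2 + 1 / (4 * s) + 8 / K * Real.sqrt (π / (8 * s)))) / ((n.valMinAbs.natAbs : ℕ) : ℝ) ^ 4 := by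
  have hK : (0 : ℝ) < K := by exact_mod_cast Nat.pos_of_ne_zero (NeZero.ne K)
  have hv : 0 < n.valMinAbs.natAbs := by
    rw [Nat.pos_iff_ne_zero, Ne, Int.natAbs_eq_zero, ZMod.valMinAbs_eq_zero]; exact hn
  have hvR : (0 : ℝ) < ((n.valMinAbs.natAbs : ℕ) : ℝ) := by exact_mod_cast hv
  have h1 := norm_cycleHeatGrad_le_of_fourth_difference (K := K) s hn
  have h2 := inv_norm_char_pow_four_le (K := K) hn
  have h3 := cycle_fourth_difference_grad_sum_le (K := K) hs
  have hS0 : 0 ≤ (K : ℝ)⁻¹ * ∑ k : ZMod K, ‖(Δ_[(1 : ZMod K)])^[4] ((fun k' : ZMod K => ((heat (2 * s) (cycAngle K k') : ℝ) : ℂ)) * (fun k' : ZMod K => (ZMod.stdAddChar k' : ℂ) - 1)) k‖ :=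
    mul_nonneg (by positivity) (Finset.sum_nonneg fun k _ => norm_nonneg _)
  have hC0 : 0 ≤ ((K : ℝ) / (4 * (n.valMinAbs.natAbs : ℕ))) ^ 4 := by positivity
  calc ‖cycleHeatGrad K s n‖ ≤ _ := h1
    _ ≤ ((K : ℝ) / (4 * (n.valMinAbs.natAbs : ℕ))) ^ 4 * ((2 * π / K) ^ 4 * ((1 + 24 * s + (8 + 40 * s) * Real.sqrt (2 * s)) * (9 * (K : ℝ)⁻¹ + Real.sqrt (π / (8 * (s / 2))))
        + (14 * s + 84 * s ^ 2) * (2 * π) * (56 / (K : ℝ) ^ 2 + 1 / (4 * s) + 8 / K * Real.sqrt (π / (8 * s))))) := mul_le_mul h2 h3 hS0 hC0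
    _ = _ := by
        field_simp
        ring

end Summit.QuantumFields.YangMills.BalabanUVNodes.N15KingModelRung.HeatKernel

end
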